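import Literature.MathematicalPhysics.QuantumLattice.VariationalEquilibriumTangentRealisation
import HarnessLib

/-!
# The conjugate densities of the equilibrium states at a coupling fill EXACTLY the subdifferential of the pressure:
# the phase-coexistence interval of a coupling direction (every finite-range lattice-fermion family on `ℤ^d`)

Topic `MathematicalPhysics/QuantumLattice` (model-free; stage S2 (ii)/(iii) «families of models, T > 0, competing orders»). Sequel of
`VariationalEquilibriumTangentRealisation` (Israel's tangent theorem along a direction: every subgradient `g` of `δ ↦ f(δ) = P(β, Ψ(θ + δ1_a))`
at `0` is `−β e_a(ω)` for an equilibrium `ω` at `θ`). With `s_k = 1/(k+1)` put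

  `D₊ = ⨅_k (f(s_k) − f(0))/s_k` (right derivative), `D₋ = ⨆_k (f(0) − f(−s_k))/s_k` (left derivative; written `(f(−s_k) − f(0))/(−s_k)`).

* `IsVarEquilibrium.neg_mul_meanEnergy_mem_Icc_oneSided`: every equilibrium `ω` at `θ` (any real `β`) has `−β e_a(ω) ∈ [D₋, D₊]`;
* `subgradient_of_mem_Icc_oneSided`: every `x ∈ [D₋, D₊]` is a subgradient of `f` at `0` (secant monotonicity of the convex `f`);
* **`exists_isVarEquilibrium_neg_mul_meanEnergy_eq_of_mem_Icc`**: hence for EVERY `x ∈ [D₋, D₊]` there is an equilibrium `ω` at `θ` with `−β e_a(ω) = x`.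

Together: **`{−β e_a(ω) : ω equilibrium at θ} = [D₋, D₊]`** — at a first-order transition in the coupling `a` (`D₋ < D₊`) every intermediate
value of the conjugate density is carried by an (infinite-volume, translation-invariant) equilibrium state, and no other value is: the rigorous
Maxwell / lever rule for the variational equilibrium states of every finite-range lattice-fermion model (for the 2D `t–t'` Hubbard family
`gcInteractionTT'`: densities of the grand-canonical equilibria at `(μ,h)` fill `[ρ₋(μ), ρ₊(μ)]`, magnetisations fill the `h`-subdifferential).

HONEST SCOPE: existence/characterisation of equilibrium states; no uniqueness; no certificate; no phase word; no definition. Everything PROVED, 0 sorry.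

## Mathlib / tree search
REUSED: `convexOn_varPressure_direction`, `exists_isVarEquilibrium_mul_meanEnergy_eq_of_subgradient` (sequel), `IsVarEquilibrium.varPressure_sub_mul_le_update`;
Mathlib `ConvexOn.secant_mono`, `exists_nat_one_div_lt`, `ciInf_le`, `le_ciSup`, `le_ciInf`, `ciSup_le`.

## References
* R. B. Israel, *Convexity in the Theory of Lattice Gases* (1979), Thm. I.2.4, §V.1. [cite: Israel1979, Thm. I.2.4]
* D. Ruelle, *Statistical Mechanics: Rigorous Results* (1969), §3.4. [cite: Ruelle1969, §3.4]
-/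

noncomputable section

namespace Literature.MathematicalPhysics.QuantumLattice

open _root_.Filter Set InfVolFermionState
open scoped _root_.Topology

section Generic

variable {d : ℕ} {ι : Type*} [Fintype ι] [DecidableEq ι] (β : ℝ) (Ψ₀ : FermionInteraction d) (Ψv : ι → FermionInteraction d)
  (R : ℝ) (θ : ι → ℝ) (a : ι)

/-- Secant monotonicity of the directional pressure from the base point `0`: for `x ≤ y`, `x, y ≠ 0`,
`(f(x) − f(0))/x ≤ (f(y) − f(0))/y`. [cite: Israel1979, Thm. I.2.4] -/
theorem varPressure_direction_secant_mono {x y : ℝ} (hx : x ≠ 0) (hy : y ≠ 0) (hxy : x ≤ y) :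
    ((FermionInteraction.linearFamily Ψ₀ Ψv (θ + Pi.single a x)).varPressure β R -
        (FermionInteraction.linearFamily Ψ₀ Ψv θ).varPressure β R) / x ≤
      ((FermionInteraction.linearFamily Ψ₀ Ψv (θ + Pi.single a y)).varPressure β R -
        (FermionInteraction.linearFamily Ψ₀ Ψv θ).varPressure β R) / y := by
  have hconv := convexOn_varPressure_direction β Ψ₀ Ψv R θ a
  have h := hconv.secant_mono (a := 0) (x := x) (y := y) (mem_univ _) (mem_univ _) (mem_univ _) hx hy hxy
  simp only [Pi.single_zero, add_zero, sub_zero] at h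
  exact h

/-- The right quotients are bounded below (by the secant at `−1`). [cite: Israel1979, Thm. I.2.4] -/
theorem bddBelow_rightQuotients :
    BddBelow (Set.range fun k : ℕ => ((FermionInteraction.linearFamily Ψ₀ Ψv (θ + Pi.single a (1 / ((k : ℝ) + 1)))).varPressure β R -
      (FermionInteraction.linearFamily Ψ₀ Ψv θ).varPressure β R) / (1 / ((k : ℝ) + 1))) := by
  refine ⟨((FermionInteraction.linearFamily Ψ₀ Ψv (θ + Pi.single a (-1))).varPressure β R -
      (FermionInteraction.linearFamily Ψ₀ Ψv θ).varPressure β R) / (-1), ?_⟩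
  rintro _ ⟨k, rfl⟩
  have hs : (0 : ℝ) < 1 / ((k : ℝ) + 1) := by positivity
  exact varPressure_direction_secant_mono β Ψ₀ Ψv R θ a (by norm_num) hs.ne' (by linarith)

/-- The left quotients are bounded above (by the secant at `1`). [cite: Israel1979, Thm. I.2.4] -/
theorem bddAbove_leftQuotients :
    BddAbove (Set.range fun k : ℕ => ((FermionInteraction.linearFamily Ψ₀ Ψv θ).varPressure β R -
      (FermionInteraction.linearFamily Ψ₀ Ψv (θ + Pi.single a (-(1 / ((k : ℝ) + 1))))).varPressure β R) / (1 / ((k : ℝ) + 1))) := by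
  refine ⟨((FermionInteraction.linearFamily Ψ₀ Ψv (θ + Pi.single a 1)).varPressure β R -
      (FermionInteraction.linearFamily Ψ₀ Ψv θ).varPressure β R) / 1, ?_⟩
  rintro _ ⟨k, rfl⟩
  have hs : (0 : ℝ) < 1 / ((k : ℝ) + 1) := by positivity
  have h := varPressure_direction_secant_mono β Ψ₀ Ψv R θ a (x := -(1 / ((k : ℝ) + 1))) (y := 1) (by linarith) one_ne_zero
    (by linarith)
  have e : ((FermionInteraction.linearFamily Ψ₀ Ψv θ).varPressure β R -
      (FermionInteraction.linearFamily Ψ₀ Ψv (θ + Pi.single a (-(1 / ((k : ℝ) + 1))))).varPressure β R) / (1 / ((k : ℝ) + 1)) =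
      ((FermionInteraction.linearFamily Ψ₀ Ψv (θ + Pi.single a (-(1 / ((k : ℝ) + 1))))).varPressure β R -
        (FermionInteraction.linearFamily Ψ₀ Ψv θ).varPressure β R) / (-(1 / ((k : ℝ) + 1))) := by
    have hk : (k : ℝ) + 1 ≠ 0 := by positivity
    field_simp
    ring
  simp only
  rw [e]
  exact h

/-- **Every equilibrium's conjugate density lies in the one-sided interval**: `D₋ ≤ −β e_a(ω) ≤ D₊` for every equilibrium `ω` at `θ`
(every real `β`). [cite: Israel1979, Thm. I.2.4] -/
theorem IsVarEquilibrium.neg_mul_meanEnergy_mem_Icc_oneSided {ω : InfVolFermionState d}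
    (hω : ω.IsVarEquilibrium β (FermionInteraction.linearFamily Ψ₀ Ψv θ) R) :
    -(β * ω.meanEnergy (Ψv a) R) ∈ Set.Icc
      (⨆ k : ℕ, ((FermionInteraction.linearFamily Ψ₀ Ψv θ).varPressure β R -
        (FermionInteraction.linearFamily Ψ₀ Ψv (θ + Pi.single a (-(1 / ((k : ℝ) + 1))))).varPressure β R) / (1 / ((k : ℝ) + 1)))
      (⨅ k : ℕ, ((FermionInteraction.linearFamily Ψ₀ Ψv (θ + Pi.single a (1 / ((k : ℝ) + 1)))).varPressure β R -
        (FermionInteraction.linearFamily Ψ₀ Ψv θ).varPressure β R) / (1 / ((k : ℝ) + 1))) := by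
  have hs0 : ∀ k : ℕ, (0 : ℝ) < 1 / ((k : ℝ) + 1) := fun k => by positivity
  constructor
  · refine ciSup_le fun k => ?_
    have h := hω.varPressure_sub_mul_le_update a (-(1 / ((k : ℝ) + 1)))
    rw [div_le_iff₀ (hs0 k)]
    linarith [h]
  · refine le_ciInf fun k => ?_
    have h := hω.varPressure_sub_mul_le_update a (1 / ((k : ℝ) + 1))
    rw [le_div_iff₀ (hs0 k)]
    linarith [h]

/-- **Every point of the one-sided interval is a subgradient** of the directional pressure at `0`: for `D₋ ≤ x ≤ D₊` and every `δ`,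
`P(θ) + xδ ≤ P(θ + δ1_a)` (secant monotonicity; `s_k ≤ |δ|` for large `k`). [cite: Israel1979, Thm. I.2.4] -/
theorem subgradient_of_mem_Icc_oneSided {x : ℝ}
    (hlo : (⨆ k : ℕ, ((FermionInteraction.linearFamily Ψ₀ Ψv θ).varPressure β R -
        (FermionInteraction.linearFamily Ψ₀ Ψv (θ + Pi.single a (-(1 / ((k : ℝ) + 1))))).varPressure β R) / (1 / ((k : ℝ) + 1))) ≤ x)
    (hhi : x ≤ ⨅ k : ℕ, ((FermionInteraction.linearFamily Ψ₀ Ψv (θ + Pi.single a (1 / ((k : ℝ) + 1)))).varPressure β R -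
        (FermionInteraction.linearFamily Ψ₀ Ψv θ).varPressure β R) / (1 / ((k : ℝ) + 1))) (δ : ℝ) :
    (FermionInteraction.linearFamily Ψ₀ Ψv θ).varPressure β R + x * δ ≤
      (FermionInteraction.linearFamily Ψ₀ Ψv (θ + Pi.single a δ)).varPressure β R := by
  rcases lt_trichotomy δ 0 with hδ | rfl | hδ
  · -- `δ < 0`: compare with a left quotient at `−s_k ≥ δ`
    obtain ⟨k, hk⟩ := exists_nat_one_div_lt (by linarith : 0 < -δ)
    have hs : (0 : ℝ) < 1 / ((k : ℝ) + 1) := by positivity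
    have hsec := varPressure_direction_secant_mono β Ψ₀ Ψv R θ a (x := δ) (y := -(1 / ((k : ℝ) + 1))) hδ.ne (by linarith)
      (by linarith)
    have hpk := le_ciSup (bddAbove_leftQuotients β Ψ₀ Ψv R θ a) k
    have e : ((FermionInteraction.linearFamily Ψ₀ Ψv θ).varPressure β R -
        (FermionInteraction.linearFamily Ψ₀ Ψv (θ + Pi.single a (-(1 / ((k : ℝ) + 1))))).varPressure β R) / (1 / ((k : ℝ) + 1)) =
        ((FermionInteraction.linearFamily Ψ₀ Ψv (θ + Pi.single a (-(1 / ((k : ℝ) + 1))))).varPressure β R -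
          (FermionInteraction.linearFamily Ψ₀ Ψv θ).varPressure β R) / (-(1 / ((k : ℝ) + 1))) := by
      have hk' : (k : ℝ) + 1 ≠ 0 := by positivity
      field_simp
      ring
    rw [e] at hpk
    -- slope(δ) ≤ slope(−s_k) ≤ D₋ ≤ x, and δ < 0 flips
    have hslope : ((FermionInteraction.linearFamily Ψ₀ Ψv (θ + Pi.single a δ)).varPressure β R -
        (FermionInteraction.linearFamily Ψ₀ Ψv θ).varPressure β R) / δ ≤ x := hsec.trans (hpk.trans hlo)
    rw [div_le_iff_of_neg hδ] at hslope
    linarith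
  · simp
  · -- `δ > 0`: compare with a right quotient at `s_k ≤ δ`
    obtain ⟨k, hk⟩ := exists_nat_one_div_lt hδ
    have hs : (0 : ℝ) < 1 / ((k : ℝ) + 1) := by positivity
    have hsec := varPressure_direction_secant_mono β Ψ₀ Ψv R θ a (x := 1 / ((k : ℝ) + 1)) (y := δ) hs.ne' hδ.ne' hk.le
    have hqk := ciInf_le (bddBelow_rightQuotients β Ψ₀ Ψv R θ a) k
    have hslope : x ≤ ((FermionInteraction.linearFamily Ψ₀ Ψv (θ + Pi.single a δ)).varPressure β R -
        (FermionInteraction.linearFamily Ψ₀ Ψv θ).varPressure β R) / δ := hhi.trans (hqk.trans hsec)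
    rw [le_div_iff₀ hδ] at hslope
    linarith

variable (hd : 0 < d)
include hd

/-- **THE COEXISTENCE INTERVAL IS FILLED BY EQUILIBRIUM STATES**: for every `x` with `D₋ ≤ x ≤ D₊` (the one-sided derivatives of the
pressure in the direction `a` at `θ`) there is a variational equilibrium state `ω` at `(β, Ψ(θ))` with `−β e_a(ω) = x`; with
`IsVarEquilibrium.neg_mul_meanEnergy_mem_Icc_oneSided` the set `{−β e_a(ω) : ω equilibrium at θ}` is EXACTLY `[D₋, D₊]` (`d ≥ 1`, every real `β`).
[cite: Israel1979, Thm. I.2.4] -/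
theorem exists_isVarEquilibrium_neg_mul_meanEnergy_eq_of_mem_Icc {x : ℝ}
    (hlo : (⨆ k : ℕ, ((FermionInteraction.linearFamily Ψ₀ Ψv θ).varPressure β R -
        (FermionInteraction.linearFamily Ψ₀ Ψv (θ + Pi.single a (-(1 / ((k : ℝ) + 1))))).varPressure β R) / (1 / ((k : ℝ) + 1))) ≤ x)
    (hhi : x ≤ ⨅ k : ℕ, ((FermionInteraction.linearFamily Ψ₀ Ψv (θ + Pi.single a (1 / ((k : ℝ) + 1)))).varPressure β R -
        (FermionInteraction.linearFamily Ψ₀ Ψv θ).varPressure β R) / (1 / ((k : ℝ) + 1))) :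
    ∃ ω : InfVolFermionState d, ω.IsVarEquilibrium β (FermionInteraction.linearFamily Ψ₀ Ψv θ) R ∧
      -(β * ω.meanEnergy (Ψv a) R) = x := by
  obtain ⟨ω, hω, he⟩ := exists_isVarEquilibrium_mul_meanEnergy_eq_of_subgradient hd β Ψ₀ Ψv R θ a
    (subgradient_of_mem_Icc_oneSided β Ψ₀ Ψv R θ a hlo hhi)
  exact ⟨ω, hω, by rw [he]; ring⟩

/-- **The interval is nonempty and realised at both ends**: `D₋ ≤ D₊`, with equilibrium states at each end.
[cite: Israel1979, Thm. I.2.4] -/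
theorem leftDeriv_le_rightDeriv_varPressure_direction :
    (⨆ k : ℕ, ((FermionInteraction.linearFamily Ψ₀ Ψv θ).varPressure β R -
        (FermionInteraction.linearFamily Ψ₀ Ψv (θ + Pi.single a (-(1 / ((k : ℝ) + 1))))).varPressure β R) / (1 / ((k : ℝ) + 1))) ≤
      ⨅ k : ℕ, ((FermionInteraction.linearFamily Ψ₀ Ψv (θ + Pi.single a (1 / ((k : ℝ) + 1)))).varPressure β R -
        (FermionInteraction.linearFamily Ψ₀ Ψv θ).varPressure β R) / (1 / ((k : ℝ) + 1)) := by
  obtain ⟨ω, hω⟩ := (FermionInteraction.linearFamily Ψ₀ Ψv θ).exists_isVarEquilibrium hd β R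
  obtain ⟨h1, h2⟩ := IsVarEquilibrium.neg_mul_meanEnergy_mem_Icc_oneSided β Ψ₀ Ψv R θ a hω
  exact h1.trans h2

end Generic

end Literature.MathematicalPhysics.QuantumLattice
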